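import Summits.Langlands.Langlands.Theorems.IrreducibilityBySelfDualityPairLBoundaryJS
import Summits.Langlands.Langlands.Theorems.IrreducibilityBySelfDualityPairLBoundaryJSSsv
import Summits.Langlands.Langlands.Theorems.IrreducibilityBySelfDualityPairLBoundaryJSStandardEntire
import Summits.Langlands.Langlands.Theorems.IrreducibilityBySelfDualityPairLBoundaryJSIsOrthoOfLocalTranslate
import Summits.Langlands.Langlands.Theorems.IrreducibilityBySelfDualityPairLBoundaryJSEqConjOfLocalTranslate
import Summits.Langlands.Langlands.Theorems.IrreducibilityBySelfDualityPairLBoundaryJSLocalPairTranslate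
import Summits.Langlands.Langlands.Theorems.IrreducibilityBySelfDualityPairLBoundaryJSOfHumphriesJo
import Summits.Langlands.Langlands.Theorems.IrreducibilityBySelfDualityPairLBoundaryJSCornerBochnerIwasawa
import Summits.Langlands.Langlands.Theorems.IrreducibilityBySelfDualityPairLBoundaryJSCornerPairTranslate
import Summits.Langlands.Langlands.Theorems.IrreducibilityBySelfDualityPairLBoundaryJSCornerPairEuler
import Summits.Langlands.Langlands.Theorems.IrreducibilityBySelfDualityPairLBoundaryJSCornerAbsMajorant
import Summits.Langlands.Langlands.Theorems.IrreducibilityBySelfDualityPairLBoundaryJSCornerAbsIdeleMoment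
import Literature.NumberTheory.Automorphic.PairLFunctionMeromorphicContinuationRankNeTwistProofs
import Literature.NumberTheory.Automorphic.ArchRankinSelbergTestVector
import Literature.NumberTheory.Automorphic.JPSSGlobalIntegralQuotientUnfolding
import Literature.NumberTheory.Automorphic.JPSSCornerWhittakerUnfolding
import Literature.NumberTheory.Automorphic.WhittakerPeriodExchange
import Literature.NumberTheory.Automorphic.TorusIwasawaTransport
import Literature.NumberTheory.Automorphic.CornerTorusIwasawaData
import Literature.NumberTheory.Automorphic.WhittakerCoeffHonestCuspForm
import Literature.NumberTheory.Automorphic.WhittakerCoeffTranslateUnramified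
import Literature.NumberTheory.Automorphic.WhittakerDecayCuspForm
import Literature.NumberTheory.Automorphic.WhittakerSupportFinite
import Literature.NumberTheory.Automorphic.RankinSelbergUnramifiedTorus
import Literature.NumberTheory.Automorphic.RankinSelbergTorusPairEuler
import Literature.NumberTheory.Automorphic.RankinSelbergTowerFiniteness
import Literature.NumberTheory.Automorphic.TorusUnitBoxEulerBound
import Literature.NumberTheory.Automorphic.TorusGeometricEulerBound
import Literature.NumberTheory.Automorphic.TorusUnitBoxUnfolding
import Literature.NumberTheory.Automorphic.IdeleUnitBoxShells
import Literature.NumberTheory.Automorphic.IdeleGroupBorel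
import Literature.MeasureTheory.Group.InvariantQuotientPiNormalized
import Mathlib.MeasureTheory.Constructions.Pi
import Mathlib.MeasureTheory.Measure.Haar.Unique

/-!
# The torus integral of the corner majorant is finite

Summit `Langlands`, sub-problem `Langlands`, helper file under `Theorems/` supporting the crux
`PairLBoundaryJS` (stmt-Langlands-13622), line `Sketch`, registered stub `stub_corner_torus_majorant`
(W-Ac, part 3 of 4): the absolute convergence of the unfolded `GL_{m+1} × GL_m` corner integral for
`Re s ≫ 0` (Cogdell (2004), §2.3; Jacquet–Piatetski-Shapiro–Shalika (1983), §2) reduced to the torus: for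
a Haar measure `νA` on `(𝔸_Kˣ)ᵐ`, a finite set `S` of finite places, bounds `R_v ≥ 1` equal to `1` off
`S`, `σ ≥ m + 1`, `E ≥ σ + m` and `M ≥ [K:ℚ] E + dim_ℝ K_∞ + 1`,

  `∫ 𝟙{|a_{l,v}|_v ≤ R_v ∀ l, v} (∏_l ∏_w min(1, ‖a_{l,w}‖^{-M})) |det a|^σ δ_B(a)⁻¹ dνA(a) < ∞`.

* `inv_pow_rpow_eq` — `((q⁻¹)^k)^e = (q^{-e})^k`;
* `lintegral_pi_majorant_lt_top` — the bound for the product `⨂_l ν₀` of a Haar measure `ν₀` on `𝔸_Kˣ`: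
  the Euler bound over the good places `v ∉ S` (`TorusUnitBoxEulerBound`: the integrand vanishes when
  some `|a_{l,v}|_v > 1` and scales by `∏_l q_v^{-μ_l e_l}`, `e_l = σ - (m - 1 - 2l) ≥ 2`, under
  `a ↦ ϖ_v^μ a`; the local factors `∏_l (1 - q_v^{-e_l})⁻¹` have a convergent product,
  `TorusGeometricEulerBound`), and on the unit box `B(Sᶜ) = ∏_l B₁(Sᶜ)` the integrand is
  `∏_l g_l(a_l)` (Tonelli over `Fin m`, `Literature.MeasureTheory.Group.lintegral_fin_nat_prod_eq_prod`), each
  `∫_{B₁(Sᶜ)} g_l dν₀ < ∞` by `CornerAbsIdeleMoment.setLIntegral_ideleUnitBox_majorant_lt_top`;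
* `lintegral_majorant_lt_top` — the bound for every Haar measure `νA = c • ⨂_l ν₀` (uniqueness);
* `stub_corner_torus_majorant` — the registered `∀`-form.

## References

* J. W. Cogdell, *Analytic theory of L-functions for GL_n* (2004), §2.3 [CogdellAnalyticTheory2004].
* H. Jacquet, I. I. Piatetski-Shapiro, J. Shalika, *Rankin–Selberg convolutions*, Amer. J. Math. 105
  (1983), §2 [JPSS1983].
-/

noncomputable section

-- `Summit.Langlands.Langlands.…` (summit = sub-problem name, D-0017 layout) trips `dupNamespace`
set_option linter.dupNamespace false

open scoped MatrixGroups Topology Pointwise ENNReal NNReal ComplexConjugate InnerProductSpace ContDiff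
-- the place subtypes indexing `mixedSpace K` are `Fintype` classically (`NormedCommRing (mixedSpace K)`)
open scoped Classical Matrix.Norms.Operator
open NumberField IsDedekindDomain MeasureTheory Measure Matrix Set Filter WithZero
open NumberField.mixedEmbedding
open Literature.NumberTheory.Automorphic AdelicGroupData
open Literature.NumberTheory.GaloisRepresentations (ideleGroup HeckeCharacter)
open Literature.MeasureTheory.Group
open Literature.RingTheory.SymmetricFunctions.SymmPoly
open ValuativeRel

-- the automorphic quotient carries the tree's Borel σ-algebra, not Mathlib's quotient σ-algebra
attribute [-instance] Quotient.instMeasurableSpace QuotientGroup.measurableSpace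

-- the house local instances, exactly as in `RankinSelbergUnfoldingIdentity`
attribute [local instance] adelicBorel borelSpace_adelic locallyCompactSpace_adelic secondCountableTopology_gl_adelic
  glAdeleBorel borelSpace_glAdele borelSpace_ideleGroup secondCountableTopology_ideleGroup

-- Mathlib idiom: the commutator Lie ring on matrices, to mention `(archGroupGL n K).lie`
attribute [local instance 100] LieRing.ofAssociativeRing


namespace Summit.Langlands.Langlands.Theorems.CornerAbsTorusMajorant

-- local compactness of `𝔸_Kˣ` (σ-finiteness of its Haar measures, Haar uniqueness on `(𝔸_Kˣ)ᵐ`)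
attribute [local instance] locallyCompactSpace_ideleGroup

/-! ### An elementary identity -/

/-- `((q⁻¹)^k)^e = (q^{-e})^k` for `q ≥ 0`, `k ∈ ℕ`, `e ∈ ℝ`. [folklore] -/
theorem inv_pow_rpow_eq {q : ℝ} (hq : 0 ≤ q) (e : ℝ) (k : ℕ) : ((q⁻¹) ^ k) ^ e = (q ^ (-e)) ^ k := by
  have hqi : 0 ≤ q⁻¹ := inv_nonneg.2 hq
  calc ((q⁻¹) ^ k) ^ e = ((q⁻¹) ^ (k : ℝ)) ^ e := by rw [Real.rpow_natCast]
    _ = (q⁻¹) ^ ((k : ℝ) * e) := by rw [Real.rpow_mul hqi]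
    _ = ((q⁻¹) ^ e) ^ (k : ℝ) := by rw [mul_comm, Real.rpow_mul hqi]
    _ = (q ^ (-e)) ^ (k : ℝ) := by rw [Real.inv_rpow hq, Real.rpow_neg hq]
    _ = (q ^ (-e)) ^ k := by rw [Real.rpow_natCast]

/-! ### The torus integral of the majorant against a product Haar measure -/

section Main

variable {m : ℕ} {K : Type} [Field K] [NumberField K]
variable [MeasurableSpace (AdeleRing (𝓞 K) K)] [BorelSpace (AdeleRing (𝓞 K) K)]

/-- **The torus integral of the corner majorant against `⨂_l ν₀` is finite** (`ν₀` a Haar measure on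
`𝔸_Kˣ`): Euler bound over the good places (`lintegral_le_iSup_prod_mul_setLIntegral_unitBox`, local
factors `∏_l (1 - q_v^{-e_l})⁻¹`, `e_l = σ - (m - 1 - 2l) ≥ 2`, `iSup_prod_inv_one_sub_residueCard_rpow_lt_top`),
and on the unit box `B(Sᶜ) = ∏_l B₁(Sᶜ)` Tonelli and the single-idele bound
`CornerAbsIdeleMoment.setLIntegral_ideleUnitBox_majorant_lt_top` (`1 ≤ e_l ≤ σ + m - 1 ≤ E`). [folklore] -/
theorem lintegral_pi_majorant_lt_top (ν₀ : Measure (ideleGroup K)) [IsHaarMeasure ν₀]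
    (S : Finset (HeightOneSpectrum (𝓞 K))) {R : HeightOneSpectrum (𝓞 K) → WithZero (Multiplicative ℤ)}
    (hR : ∀ v, 1 ≤ R v) (hRS : ∀ v ∉ S, R v = 1) {σ : ℝ} (hσ : (m : ℝ) + 1 ≤ σ) {E M : ℕ}
    (hE : σ + m ≤ E) (hM : Module.finrank ℚ K * E + Module.finrank ℝ (mixedSpace K) + 1 ≤ M) :
    ∫⁻ a, (if ∀ (l : Fin m) (v : HeightOneSpectrum (𝓞 K)),
            Valued.v (((a l : ideleGroup K) : AdeleRing (𝓞 K) K).2 v) ≤ R v then 1 else 0) *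
        ENNReal.ofReal (∏ l : Fin m, ∏ w : InfinitePlace K,
          ((max 1 ‖((a l : ideleGroup K) : AdeleRing (𝓞 K) K).1 w‖) ^ M)⁻¹) *
        ENNReal.ofReal (torusWeight m K σ a) ∂(Measure.pi fun _ : Fin m => ν₀) < ⊤ := by
  -- the exponents `e_l = σ - (m - 1 - 2 l) ∈ [2, E]`
  have hl_le : ∀ l : Fin m, ((l : ℕ) : ℝ) + 1 ≤ (m : ℝ) := fun l => by
    exact_mod_cast Nat.lt_iff_add_one_le.1 l.2
  have he2 : ∀ l : Fin m, (2 : ℝ) ≤ σ - ((m : ℝ) - 1 - 2 * ((l : ℕ) : ℝ)) := fun l => by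
    have h0 : (0 : ℝ) ≤ ((l : ℕ) : ℝ) := Nat.cast_nonneg _
    linarith
  have he1 : ∀ l : Fin m, (1 : ℝ) ≤ σ - ((m : ℝ) - 1 - 2 * ((l : ℕ) : ℝ)) := fun l => by linarith [he2 l]
  have heE : ∀ l : Fin m, σ - ((m : ℝ) - 1 - 2 * ((l : ℕ) : ℝ)) ≤ (E : ℝ) := fun l => by
    linarith [hl_le l]
  -- the one-coordinate factors and the integrand
  set g : Fin m → ideleGroup K → ℝ≥0∞ := fun l y =>
    (if ∀ v, Valued.v (((y : ideleGroup K) : AdeleRing (𝓞 K) K).2 v) ≤ R v then 1 else 0) *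
      ENNReal.ofReal (∏ w : InfinitePlace K, ((max 1 ‖((y : ideleGroup K) : AdeleRing (𝓞 K) K).1 w‖) ^ M)⁻¹) *
      ENNReal.ofReal ((IdeleClassGroup.ideleNorm K y : ℝ) ^ (σ - ((m : ℝ) - 1 - 2 * ((l : ℕ) : ℝ))))
    with hg_def
  set F : (Fin m → ideleGroup K) → ℝ≥0∞ := fun a =>
    (if ∀ (l : Fin m) (v : HeightOneSpectrum (𝓞 K)),
        Valued.v (((a l : ideleGroup K) : AdeleRing (𝓞 K) K).2 v) ≤ R v then 1 else 0) *
      ENNReal.ofReal (∏ l : Fin m, ∏ w : InfinitePlace K,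
        ((max 1 ‖((a l : ideleGroup K) : AdeleRing (𝓞 K) K).1 w‖) ^ M)⁻¹) *
      ENNReal.ofReal (torusWeight m K σ a) with hF_def
  -- (1) the integrand is the product of the one-coordinate factors
  have hFg : ∀ a, F a = ∏ l, g l (a l) := by
    intro a
    simp only [hF_def, hg_def]
    rw [Finset.prod_mul_distrib, Finset.prod_mul_distrib]
    congr 1
    · congr 1
      · by_cases h : ∀ (l : Fin m) (v : HeightOneSpectrum (𝓞 K)),
            Valued.v (((a l : ideleGroup K) : AdeleRing (𝓞 K) K).2 v) ≤ R v
        · rw [if_pos h]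
          exact (Finset.prod_eq_one fun l _ => if_pos (h l)).symm
        · obtain ⟨l, hl⟩ := not_forall.1 h
          rw [if_neg h]
          exact (Finset.prod_eq_zero (Finset.mem_univ l) (if_neg hl)).symm
      · exact ENNReal.ofReal_prod_of_nonneg fun l _ => Finset.prod_nonneg fun w _ =>
          inv_nonneg.2 (pow_nonneg (le_trans zero_le_one (le_max_left _ _)) M)
    · unfold torusWeight
      exact ENNReal.ofReal_prod_of_nonneg fun l _ => Real.rpow_nonneg (NNReal.coe_nonneg _) _
  -- (2) measurability
  have hg_meas : ∀ l, Measurable (g l) := by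
    intro l
    simp only [hg_def]
    refine ((Measurable.ite ?_ measurable_const measurable_const).mul ?_).mul ?_
    · have hset : {y : ideleGroup K | ∀ v, Valued.v (((y : ideleGroup K) : AdeleRing (𝓞 K) K).2 v) ≤ R v} =
          ⋂ v, (fun y : ideleGroup K => adeleEval K v ((y : ideleGroup K) : AdeleRing (𝓞 K) K)) ⁻¹'
            {x | Valued.v x ≤ R v} := by
        ext y
        simp only [Set.mem_setOf_eq, Set.mem_iInter, Set.mem_preimage, adeleEval_apply]
      rw [hset]
      exact (isClosed_iInter fun v => (isClosed_setOf_valued_le K v (R v)).preimage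
        ((continuous_adeleEval K v).comp Units.continuous_val)).measurableSet
    · refine ENNReal.measurable_ofReal.comp (Continuous.measurable ?_)
      refine continuous_finsetProd _ fun w _ => ?_
      refine ((continuous_const.max ?_).pow M).inv₀ fun y => ?_
      · exact ((continuous_apply w).comp (continuous_fst.comp Units.continuous_val)).norm
      · exact (pow_pos (lt_of_lt_of_le one_pos (le_max_left _ _)) M).ne'
    · refine ENNReal.measurable_ofReal.comp (Continuous.measurable ?_)
      exact (NNReal.continuous_coe.comp (continuous_ideleNorm_holds K)).rpow_const fun y =>
        Or.inl (ideleNorm_coe_pos K y).ne'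
  have hF_meas : Measurable F := by
    rw [show F = fun a => ∏ l, g l (a l) from funext hFg]
    exact Finset.measurable_prod _ fun l _ => (hg_meas l).comp (measurable_pi_apply l)
  -- (3) uniformizers and the behaviour under `a ↦ ϖ_v^μ a` at a good place `v ∉ S`
  obtain ⟨ϖ, hϖ⟩ := exists_uniformizers (K := K)
  have hq0 : ∀ v : HeightOneSpectrum (𝓞 K), (0 : ℝ) ≤ (v.residueCard : ℝ) := fun v => Nat.cast_nonneg _
  have htw : ∀ (v : HeightOneSpectrum (𝓞 K)) (mu : Fin m → ℕ),
      ENNReal.ofReal (torusWeight m K σ (localTorusPow (ϖ v) mu)) =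
        ∏ l : Fin m, ENNReal.ofReal ((v.residueCard : ℝ) ^ (-(σ - ((m : ℝ) - 1 - 2 * ((l : ℕ) : ℝ))))) ^ mu l := by
    intro v mu
    unfold torusWeight
    rw [ENNReal.ofReal_prod_of_nonneg fun l _ => Real.rpow_nonneg (NNReal.coe_nonneg _) _]
    refine Finset.prod_congr rfl fun l _ => ?_
    rw [ideleNorm_localTorusPow (hϖ v) mu l, inv_pow_rpow_eq (hq0 v), ENNReal.ofReal_pow (Real.rpow_nonneg (hq0 v) _)]
  have hscale : ∀ v ∈ ({v | v ∉ S} : Set (HeightOneSpectrum (𝓞 K))), ∀ (mu : Fin m → ℕ) (a : Fin m → ideleGroup K),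
      (∀ i, Valued.v (((a i : ideleGroup K) : AdeleRing (𝓞 K) K).2 v) = 1) →
      F (localTorusPow (ϖ v) mu * a) =
        (∏ l : Fin m, ENNReal.ofReal ((v.residueCard : ℝ) ^ (-(σ - ((m : ℝ) - 1 - 2 * ((l : ℕ) : ℝ))))) ^ mu l) * F a := by
    intro v hv mu a ha
    have hvS : v ∉ S := hv
    rw [← htw v mu]
    -- the indicator and the archimedean factor are unchanged
    have hind : (∀ (l : Fin m) (w : HeightOneSpectrum (𝓞 K)),
        Valued.v ((((localTorusPow (ϖ v) mu * a) l : ideleGroup K) : AdeleRing (𝓞 K) K).2 w) ≤ R w) ↔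
        ∀ (l : Fin m) (w : HeightOneSpectrum (𝓞 K)), Valued.v (((a l : ideleGroup K) : AdeleRing (𝓞 K) K).2 w) ≤ R w := by
      refine forall_congr' fun l => forall_congr' fun w => ?_
      by_cases hwv : w = v
      · rw [hwv, valued_localTorusPow_mul_apply (hϖ v) mu ha l, ha l, hRS v hvS]
        refine ⟨fun _ => le_rfl, fun _ => ?_⟩
        rw [← WithZero.exp_zero, WithZero.exp_le_exp]
        omega
      · rw [valued_localTorusPow_mul_apply_of_ne mu a hwv l]
    have harch : ∀ (l : Fin m) (w : InfinitePlace K),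
        (((localTorusPow (ϖ v) mu * a) l : ideleGroup K) : AdeleRing (𝓞 K) K).1 w =
          ((a l : ideleGroup K) : AdeleRing (𝓞 K) K).1 w := by
      intro l w
      have h1 : (((localTorusPow (ϖ v) mu * a) l : ideleGroup K) : AdeleRing (𝓞 K) K).1 =
          ((localTorusPow (ϖ v) mu l : ideleGroup K) : AdeleRing (𝓞 K) K).1 *
            ((a l : ideleGroup K) : AdeleRing (𝓞 K) K).1 := rfl
      rw [h1, localTorusPow_fst, one_mul]
    simp only [hF_def, hind, harch]
    rw [torusWeight_mul, ENNReal.ofReal_mul (torusWeight_nonneg _ _)]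
    ring
  have hsupp : ∀ v ∈ ({v | v ∉ S} : Set (HeightOneSpectrum (𝓞 K))), ∀ a : Fin m → ideleGroup K,
      (∃ i, 1 < Valued.v (((a i : ideleGroup K) : AdeleRing (𝓞 K) K).2 v)) → F a = 0 := by
    intro v hv a hi
    obtain ⟨i, hi⟩ := hi
    have hvS : v ∉ S := hv
    simp only [hF_def]
    rw [if_neg, zero_mul, zero_mul]
    intro h
    have h' := h i v
    rw [hRS v hvS] at h'
    exact not_lt.2 h' hi
  -- (4) the Euler bound over the good places
  have hEuler := lintegral_le_iSup_prod_mul_setLIntegral_unitBox (Measure.pi fun _ : Fin m => ν₀)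
    ({v | v ∉ S} : Set (HeightOneSpectrum (𝓞 K))) (fun v _ => hϖ v) hF_meas
    (fun v mu => ∏ l : Fin m, ENNReal.ofReal ((v.residueCard : ℝ) ^ (-(σ - ((m : ℝ) - 1 - 2 * ((l : ℕ) : ℝ))))) ^ mu l)
    hscale hsupp
  refine lt_of_le_of_lt hEuler (ENNReal.mul_lt_top ?_ ?_)
  · -- (5) the Euler product of the local factors `∏_l (1 - q_v^{-e_l})⁻¹` converges (`e_l ≥ 2`)
    have hsum : ∀ v : HeightOneSpectrum (𝓞 K),
        ∑' mu : Fin m → ℕ, ∏ l : Fin m, ENNReal.ofReal ((v.residueCard : ℝ) ^ (-(σ - ((m : ℝ) - 1 - 2 * ((l : ℕ) : ℝ))))) ^ mu l =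
          ∏ l : Fin m, (1 - ENNReal.ofReal ((v.residueCard : ℝ) ^ (-(σ - ((m : ℝ) - 1 - 2 * ((l : ℕ) : ℝ))))))⁻¹ :=
      fun v => tsum_prod_pow_eq_prod_inv_one_sub _
    simp only [hsum]
    exact iSup_prod_inv_one_sub_residueCard_rpow_lt_top (fun l : Fin m => σ - ((m : ℝ) - 1 - 2 * ((l : ℕ) : ℝ)))
      (fun l => lt_of_lt_of_le one_lt_two (he2 l)) _
  · -- (6) the unit box `B(Sᶜ)` is a product box and the integrand a product: Tonelli
    have hset : unitBox (n := m) (K := K) ({v | v ∉ S} : Set (HeightOneSpectrum (𝓞 K))) =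
        Set.pi Set.univ (fun _ : Fin m => ideleUnitBox (K := K) {v | v ∉ S}) := by
      ext a
      simp only [unitBox, ideleUnitBox, Set.mem_setOf_eq, Set.mem_univ_pi]
      exact ⟨fun h i w hw => h w hw i, fun h w hw i => h i w hw⟩
    simp only [hFg]
    rw [hset, Measure.restrict_pi_pi, lintegral_fin_nat_prod_eq_prod _ hg_meas]
    refine ENNReal.prod_lt_top fun l _ => ?_
    simp only [hg_def]
    exact CornerAbsIdeleMoment.setLIntegral_ideleUnitBox_majorant_lt_top ν₀ S hR (he1 l) (heE l) hM

/-- **The torus integral of the corner majorant is finite for every Haar measure on `(𝔸_Kˣ)ᵐ`**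
(`νA = c • ⨂_l ν₀` by the uniqueness of Haar measures on the second countable locally compact group
`(𝔸_Kˣ)ᵐ`, and `lintegral_pi_majorant_lt_top`). [folklore] -/
theorem lintegral_majorant_lt_top (νA : Measure (Fin m → ideleGroup K)) [IsHaarMeasure νA]
    (S : Finset (HeightOneSpectrum (𝓞 K))) {R : HeightOneSpectrum (𝓞 K) → WithZero (Multiplicative ℤ)}
    (hR : ∀ v, 1 ≤ R v) (hRS : ∀ v ∉ S, R v = 1) {σ : ℝ} (hσ : (m : ℝ) + 1 ≤ σ) {E M : ℕ}
    (hE : σ + m ≤ E) (hM : Module.finrank ℚ K * E + Module.finrank ℝ (mixedSpace K) + 1 ≤ M) :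
    ∫⁻ a, (if ∀ (l : Fin m) (v : HeightOneSpectrum (𝓞 K)),
            Valued.v (((a l : ideleGroup K) : AdeleRing (𝓞 K) K).2 v) ≤ R v then 1 else 0) *
        ENNReal.ofReal (∏ l : Fin m, ∏ w : InfinitePlace K,
          ((max 1 ‖((a l : ideleGroup K) : AdeleRing (𝓞 K) K).1 w‖) ^ M)⁻¹) *
        ENNReal.ofReal (torusWeight m K σ a) ∂νA < ⊤ := by
  obtain ⟨ν₀, hν₀⟩ := exists_isHaarMeasure_ideleGroup K
  have h := isMulLeftInvariant_eq_smul νA (Measure.pi fun _ : Fin m => ν₀)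
  rw [h, lintegral_smul_measure, ENNReal.smul_def, smul_eq_mul]
  exact ENNReal.mul_lt_top ENNReal.coe_lt_top (lintegral_pi_majorant_lt_top ν₀ S hR hRS hσ hE hM)

end Main

/-! ### The registered stub -/

/-- **STUB (W-Ac 3/4) — the torus integral of the corner majorant is finite for `σ ≥ m + 1`**: for a
Haar measure `νA` on `(𝔸_Kˣ)ᵐ`, a finite set `S` of finite places, bounds `R_v ≥ 1` equal to `1` off `S`,
`σ ≥ m + 1`, `E ≥ σ + m` and `M ≥ [K:ℚ]E + dim_ℝ K_∞ + 1`: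
`∫ 𝟙{|a_{l,v}|_v ≤ R_v} (∏_l ∏_w min(1, ‖a_{l,w}‖^{-M})) |det a|^σ δ_B(a)⁻¹ dνA(a) < ∞`, the `∀`-form of
`lintegral_majorant_lt_top` (Cogdell (2004), §2.3: absolute convergence of the unfolded corner integral
for `Re s ≫ 0`). [folklore] -/
theorem stub_corner_torus_majorant :
    ∀ {m : ℕ} {K : Type} [Field K] [NumberField K]
      [MeasurableSpace (AdeleRing (𝓞 K) K)] [BorelSpace (AdeleRing (𝓞 K) K)]
      (νA : Measure (Fin m → ideleGroup K)) [IsHaarMeasure νA]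
      (S : Finset (HeightOneSpectrum (𝓞 K))) {R : HeightOneSpectrum (𝓞 K) → WithZero (Multiplicative ℤ)},
      (∀ v, 1 ≤ R v) → (∀ v ∉ S, R v = 1) →
      ∀ {σ : ℝ}, (m : ℝ) + 1 ≤ σ → ∀ {E M : ℕ}, σ + m ≤ E →
      Module.finrank ℚ K * E + Module.finrank ℝ (mixedSpace K) + 1 ≤ M →
      ∫⁻ a, (if ∀ (l : Fin m) (v : HeightOneSpectrum (𝓞 K)),
              Valued.v (((a l : ideleGroup K) : AdeleRing (𝓞 K) K).2 v) ≤ R v then 1 else 0) *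
          ENNReal.ofReal (∏ l : Fin m, ∏ w : InfinitePlace K,
            ((max 1 ‖((a l : ideleGroup K) : AdeleRing (𝓞 K) K).1 w‖) ^ M)⁻¹) *
          ENNReal.ofReal (torusWeight m K σ a) ∂νA < ⊤ := by
  intro m K _ _ _ _ νA _ S R hR hRS σ hσ E M hE hM
  exact lintegral_majorant_lt_top νA S hR hRS hσ hE hM

end Summit.Langlands.Langlands.Theorems.CornerAbsTorusMajorant

end
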